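import Summits.ResolutionOfSingularities.ResolutionOfSingularities.Theorems.FrobeniusLadderFInjectiveMacaulayficationPencilDeepSupportFedder
import HarnessLib

/-!
# (T-register, lemma TC-β — kernel brick) FEDDER RESTRICTION TO A DIVISOR LETTER: `X·g` passes Fedderʼs test at a point of `{X = 0}` iff `g|_{X=0}` does — `(X·g)^{p−1} ∉ 𝔪^{[p]} ⟺
# (g|_{X=0})^{p−1} ∉ 𝔪₀^{[p]}`; and if `g|_{X=0} = c·Q²` with `Q` vanishing at the point then `X·g` is NEVER F-pure there (every prime `p`)
# (crux `FInjectiveMacaulayfication` stmt-ResolutionOfSingularities-15315, chain w45a; res-L1-w45a-plan-1 RULING R24.37 «KERNEL CANDIDATE TC-β as a Fedder statement “X·g FULL ⟺ g mod X F-pure”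
# in MvPolynomial form» and R24.42 (c) «stub-1 g16 — ASSIGNMENT: the TC-β KERNEL BRICK in Fedder-restriction form … `fpure_X_mul_iff` + the corollary g|_{X=0} = c·Q² only if cheap»;
# res-L1-w45a-tri-2 g22 `TC-CONE-TRANSFER-BREAKTEST-tri2.md` (iii) LEMMA TC-β; consumer res-L1-w45a-lead-1 `Lines/T-cone-transfer.md` regime β; seat res-L1-w45a-stub-1 g16)

[OURS · L1 W4.5a] Support file (`--supports stmt-ResolutionOfSingularities-15315 --as helper`); theorems only; GENERIC (any field `k`, any number `n` of further variables, any `g`); no named fact;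
NOT a statement of any manuscript; nothing of the crux is proved (a Fedder-test bookkeeping lemma, evidence for the T-register only). AI-written (AI review is weaker than expert review).

LETTERS (as in ✓ `WildCoverFedder` / ✓p712178 `PencilDeepSupportFedder`): `S = k[X, y₁, …, yₙ] = MvPolynomial (Fin (n+1)) k` with `X = X 0`, `yᵢ = X i.succ`; the RESTRICTION TO THE DIVISOR
`σ g := aeval (Fin.cons 0 X) g ∈ k[y₁..yₙ]` («`g mod X`»: `X ↦ 0`, `yᵢ ↦ yᵢ`); a `k`-point `(0; β)` ON `{X = 0}` with Frobenius-power ideals `J_{(0;β)} = (X^p, (yᵢ − βᵢ)^p)` upstairs and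
`I_β = ((yᵢ − βᵢ)^p)` downstairs. By Fedder (✓ `fedder_criterion_maximalIdeal`) the hypersurface `{X·g = 0}` satisfies the cruxʼs stalk clause at `(0; β)` iff `(X·g)^{p−1} ∉ J_{(0;β)}`.
* §1 `exists_eq_rename_restrict_add_X_mul` — `g = (σ g)⁺ + X·q` (`q⁺ = rename Fin.succ q`); `X_pow_mul_mem_iff` — `X^{p−1}·h ∈ J_{(0;β)} ↔ σ h ∈ I_β` (the `X^{p−1}`-coefficient, ✓p712178
  `mem_of_X_pow_mul_rename_mem`); ★ `X_mul_pow_mem_iff` / ★ `fpure_X_mul_iff` — `(X·g)^{p−1} ∈ J_{(0;β)} ↔ (σ g)^{p−1} ∈ I_β` (resp. the `∉` form): **`X·g` PASSES FEDDER AT `(0; β)` IFF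
  `g|_{X=0}` PASSES FEDDER AT `β`** — lemma TC-β of the break-test.
* §2 ★★ `clause_X_mul_iff` — the stalk clause `CMCl ∧ FCl p` of `k[X,y]_P/(X·g)` at `P = (0; β)` ⟺ `(σ g)^{p−1} ∉ I_β` (`g ≠ 0`; no `FullCl` form: `X·g` is not a domain).
* §3 `pow_char_mem_span_pow` (Frobenius: `ℓ ∈ (a_i) ⇒ ℓ^p ∈ (a_i^p)`, any family, any ring of characteristic `p`), ★ `X_mul_pow_mem_of_restrict_eq_mul_sq` — if `σ g = c·Q²` with `Q ∈ (yᵢ − βᵢ)`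
  then `(X·g)^{p−1} ∈ J_{(0;β)}` for EVERY prime `p` and any `c` (`Q^p ∈ I_β`, `2(p−1) ≥ p`): the regime-β cancellation «`g|₀ = c·Q²` ⇒ NEVER FULL» with the exact hypothesis `Q(β) = 0`, nothing more.
SHADOW MAP (T-side statements of `T-cone-transfer.md` / the break-test these decls shadow): LEMMA TC-β «X·g FULL ⟺ g|_{X=0} F-pure» = `fpure_X_mul_iff` (Fedder form) and `clause_X_mul_iff`
(stalk-clause form); «exact cancellation with ℓ₀ = 0 gives g|₀ = c·Q² ⇒ NEVER FULL» = `X_mul_pow_mem_of_restrict_eq_mul_sq`. SCOPE: statements at `k`-RATIONAL points `(0; β)` of the divisor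
only (Frobenius-power ideals of `k`-points); nothing is claimed at non-rational closed points or at non-closed points of `{X = 0}`, and `g` is a polynomial (no power series).
[cite: Fedder1983, Prop. 1.7 and Thm. 1.12] [folklore computation]
-/

set_option linter.dupNamespace false

noncomputable section

open MvPolynomial IsLocalRing

namespace Summit.ResolutionOfSingularities.ResolutionOfSingularities.Theorems.FInjectiveMacaulayfication.FullXMulRestriction

open Summit.ResolutionOfSingularities.ResolutionOfSingularities.Theorems.FInjectiveMacaulayfication
open WildCoverFedder PencilDeepSupportFedder SliceableCentre

/-! ## §1 `X^{p−1}·h` modulo `J_{(0;β)}` is read off the restriction `h|_{X=0}` -/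

section Algebra

variable (k : Type) [Field k] (n : ℕ)

/-- **`g = (g|_{X=0})⁺ + X·q`**: every polynomial is its restriction to `{X = 0}` (re-embedded `X`-free) plus a multiple of `X`. [elementary] -/
theorem exists_eq_rename_restrict_add_X_mul (g : MvPolynomial (Fin (n + 1)) k) :
    ∃ q : MvPolynomial (Fin (n + 1)) k, g = rename Fin.succ ((aeval (Fin.cons 0 X : Fin (n + 1) → MvPolynomial (Fin n) k)) g) + X 0 * q := by
  induction g using MvPolynomial.induction_on with
  | C a => exact ⟨0, by rw [mul_zero, add_zero, aeval_C, algebraMap_eq, rename_C]⟩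
  | add p q hp hq =>
    obtain ⟨a, ha⟩ := hp
    obtain ⟨b, hb⟩ := hq
    refine ⟨a + b, ?_⟩
    conv_lhs => rw [ha, hb]
    rw [map_add, map_add]
    ring
  | mul_X p i hp =>
    obtain ⟨a, ha⟩ := hp
    refine Fin.cases ?_ (fun j => ?_) i
    · refine ⟨p, ?_⟩
      rw [map_mul, aeval_X, Fin.cons_zero, mul_zero, map_zero, zero_add, mul_comm]
    · refine ⟨a * X j.succ, ?_⟩
      rw [map_mul, aeval_X, Fin.cons_succ, map_mul, rename_X]
      conv_lhs => rw [ha]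
      ring

/-- ★ **`X^{p−1}·h ∈ J_{(0;β)} ↔ h|_{X=0} ∈ I_β`** (`p ≥ 1`): only the `X^{p−1}`-coefficient of `X^{p−1}·h` below `X^p` survives, and it is the restriction. [folklore; ✓p712178 `mem_of_X_pow_mul_rename_mem`] -/
theorem X_pow_mul_mem_iff {p : ℕ} (hp : p ≠ 0) (β : Fin n → k) (h : MvPolynomial (Fin (n + 1)) k) :
    (X 0 : MvPolynomial (Fin (n + 1)) k) ^ (p - 1) * h ∈ Ideal.span (Set.range fun j : Fin (n + 1) => (X j - C (Fin.cons 0 β j) : MvPolynomial (Fin (n + 1)) k) ^ p) ↔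
      (aeval (Fin.cons 0 X : Fin (n + 1) → MvPolynomial (Fin n) k)) h ∈ Ideal.span (Set.range fun i : Fin n => (X i - C (β i) : MvPolynomial (Fin n) k) ^ p) := by
  set J : Ideal (MvPolynomial (Fin (n + 1)) k) := Ideal.span (Set.range fun j : Fin (n + 1) => (X j - C (Fin.cons 0 β j) : MvPolynomial (Fin (n + 1)) k) ^ p) with hJ
  obtain ⟨q, hq⟩ := exists_eq_rename_restrict_add_X_mul k n h
  have hXp : (X 0 : MvPolynomial (Fin (n + 1)) k) ^ p ∈ J := by
    have : (X 0 : MvPolynomial (Fin (n + 1)) k) ^ p = (X 0 - C ((Fin.cons 0 β : Fin (n + 1) → k) 0)) ^ p := by rw [Fin.cons_zero, C_0, sub_zero]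
    rw [this]; exact Ideal.subset_span ⟨0, rfl⟩
  have htail : (X 0 : MvPolynomial (Fin (n + 1)) k) ^ (p - 1) * (X 0 * q) ∈ J := by
    rw [← mul_assoc, ← pow_succ, Nat.sub_add_cancel (Nat.pos_of_ne_zero hp)]
    exact Ideal.mul_mem_right _ _ hXp
  have hsplit : (X 0 : MvPolynomial (Fin (n + 1)) k) ^ (p - 1) * h =
      X 0 ^ (p - 1) * rename Fin.succ ((aeval (Fin.cons 0 X : Fin (n + 1) → MvPolynomial (Fin n) k)) h) + X 0 ^ (p - 1) * (X 0 * q) := by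
    conv_lhs => rw [hq]
    ring
  rw [hsplit]
  constructor
  · intro hmem
    have h1 : (X 0 : MvPolynomial (Fin (n + 1)) k) ^ (p - 1) * rename Fin.succ ((aeval (Fin.cons 0 X : Fin (n + 1) → MvPolynomial (Fin n) k)) h) ∈ J := by
      have := J.sub_mem hmem htail
      rwa [add_sub_cancel_right] at this
    exact mem_of_X_pow_mul_rename_mem k n β _ (Nat.sub_lt (Nat.pos_of_ne_zero hp) Nat.one_pos) h1
  · intro hmem
    exact J.add_mem (Ideal.mul_mem_left _ _ (rename_mem_span_pow_of_mem k n 0 β hmem)) htail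

/-- ★ **`(X·g)^{p−1} ∈ J_{(0;β)} ↔ (g|_{X=0})^{p−1} ∈ I_β`** (`p ≥ 1`). [OURS · lemma TC-β, membership form] -/
theorem X_mul_pow_mem_iff {p : ℕ} (hp : p ≠ 0) (β : Fin n → k) (g : MvPolynomial (Fin (n + 1)) k) :
    (X 0 * g : MvPolynomial (Fin (n + 1)) k) ^ (p - 1) ∈ Ideal.span (Set.range fun j : Fin (n + 1) => (X j - C (Fin.cons 0 β j) : MvPolynomial (Fin (n + 1)) k) ^ p) ↔
      ((aeval (Fin.cons 0 X : Fin (n + 1) → MvPolynomial (Fin n) k)) g) ^ (p - 1) ∈ Ideal.span (Set.range fun i : Fin n => (X i - C (β i) : MvPolynomial (Fin n) k) ^ p) := by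
  rw [mul_pow, X_pow_mul_mem_iff k n hp β, map_pow]

/-- ★ **LEMMA TC-β (Fedder form): `X·g` PASSES FEDDERʼS TEST AT THE `k`-POINT `(0; β)` IFF `g|_{X=0}` PASSES IT AT `β`** — `(X·g)^{p−1} ∉ (X^p, (yᵢ − βᵢ)^p) ⟺ (g|_{X=0})^{p−1} ∉
((yᵢ − βᵢ)^p)`. Shadows «X·g FULL ⟺ g|_{X=0} F-pure» of `T-cone-transfer.md` (regime β) at `k`-rational points of the divisor (no claim elsewhere). [OURS · R24.37 / R24.42 (c); cite:
Fedder1983, Thm. 1.12 (context)] -/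
theorem fpure_X_mul_iff {p : ℕ} (hp : p ≠ 0) (β : Fin n → k) (g : MvPolynomial (Fin (n + 1)) k) :
    (X 0 * g : MvPolynomial (Fin (n + 1)) k) ^ (p - 1) ∉ Ideal.span (Set.range fun j : Fin (n + 1) => (X j - C (Fin.cons 0 β j) : MvPolynomial (Fin (n + 1)) k) ^ p) ↔
      ((aeval (Fin.cons 0 X : Fin (n + 1) → MvPolynomial (Fin n) k)) g) ^ (p - 1) ∉ Ideal.span (Set.range fun i : Fin n => (X i - C (β i) : MvPolynomial (Fin n) k) ^ p) :=
  (X_mul_pow_mem_iff k n hp β g).not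

end Algebra

/-! ## §2 The stalk clause of `{X·g = 0}` at a point of the divisor -/

section Fedder

variable (k : Type) [Field k] (n : ℕ) (p : ℕ) [Fact p.Prime] [CharP k p]

omit [CharP k p] in
/-- `X·g ≠ 0` for `g ≠ 0`. [plumbing] -/
theorem X_mul_ne_zero (g : MvPolynomial (Fin (n + 1)) k) (hg : g ≠ 0) : (X 0 * g : MvPolynomial (Fin (n + 1)) k) ≠ 0 :=
  mul_ne_zero (X_ne_zero _) hg

omit [Fact p.Prime] [CharP k p] in
/-- `X·g` lies in the point ideal `(X, yᵢ − βᵢ)`. [plumbing] -/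
theorem X_mul_mem_point (β : Fin n → k) (g : MvPolynomial (Fin (n + 1)) k) (P : Ideal (MvPolynomial (Fin (n + 1)) k))
    (hP : P = Ideal.span (Set.range fun j : Fin (n + 1) => (X j - C (Fin.cons 0 β j) : MvPolynomial (Fin (n + 1)) k))) : (X 0 * g : MvPolynomial (Fin (n + 1)) k) ∈ P := by
  rw [hP]
  refine Ideal.mul_mem_right _ _ (Ideal.subset_span ⟨0, ?_⟩)
  simp only [Fin.cons_zero, C_0, sub_zero]

/-- ★★ **THE STALK CLAUSE OF `{X·g = 0}` AT A `k`-POINT `(0; β)` OF THE DIVISOR**: `CMCl ∧ FCl p` of `k[X, y]_P/(X·g)` (`P = (X, yᵢ − βᵢ)` a `k`-rational point, `g ≠ 0`) holds iff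
the restriction `g|_{X=0}` passes Fedderʼs test at `β`: `(g|_{X=0})^{p−1} ∉ ((yᵢ − βᵢ)^p)`. Shadows lemma TC-β of `T-cone-transfer.md` in stalk form; `k`-points only. [OURS · lemma TC-β,
clause form; cite: Fedder1983, Prop. 1.7 and Thm. 1.12] -/
theorem clause_X_mul_iff (β : Fin n → k) (g : MvPolynomial (Fin (n + 1)) k) (hg : g ≠ 0)
    (P : Ideal (MvPolynomial (Fin (n + 1)) k)) [P.IsMaximal]
    (hP : P = Ideal.span (Set.range fun j : Fin (n + 1) => (X j - C (Fin.cons 0 β j) : MvPolynomial (Fin (n + 1)) k))) :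
    (CMCl (Localization.AtPrime P ⧸ Ideal.span {algebraMap (MvPolynomial (Fin (n + 1)) k) (Localization.AtPrime P) (X 0 * g)}) ∧
      FCl p (Localization.AtPrime P ⧸ Ideal.span {algebraMap (MvPolynomial (Fin (n + 1)) k) (Localization.AtPrime P) (X 0 * g)})) ↔
      ((aeval (Fin.cons 0 X : Fin (n + 1) → MvPolynomial (Fin n) k)) g) ^ (p - 1) ∉ Ideal.span (Set.range fun i : Fin n => (X i - C (β i) : MvPolynomial (Fin n) k) ^ p) := by
  rw [SeparableBaseChangeAscent.cmCl_and_fCl_iff,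
    FedderAtMaximalIdeal.fedder_criterion_maximalIdeal k (n + 1) (n + 1) p P _ hP _ (X_mul_mem_point k n β g P hP) (X_mul_ne_zero k n g hg),
    fpure_X_mul_iff k n (Fact.out : p.Prime).ne_zero β g]

end Fedder

/-! ## §3 The regime-β corollary: `g|_{X=0} = c·Q²` with `Q(β) = 0` is never F-pure -/

/-- **Frobenius carries `(aᵢ)` into `(aᵢ^p)`**: in a commutative ring of characteristic `p`, `ℓ ∈ (aᵢ)_i ⇒ ℓ^p ∈ (aᵢ^p)_i` (any family `a`). [folklore; the family version of ✓p712909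
`FullPthPowerEdge.pow_char_mem_frobeniusPower`] -/
theorem pow_char_mem_span_pow {B : Type} [CommRing B] (p : ℕ) [Fact p.Prime] [CharP B p] {ι : Type} (a : ι → B) (ℓ : B) (hℓ : ℓ ∈ Ideal.span (Set.range a)) :
    ℓ ^ p ∈ Ideal.span (Set.range fun i => a i ^ p) := by
  have hmap : (Ideal.span (Set.range a)).map (frobenius B p) = Ideal.span (Set.range fun i => a i ^ p) := by
    rw [Ideal.map_span, ← Set.range_comp]
    rfl
  rw [← frobenius_def, ← hmap]
  exact Ideal.mem_map_of_mem _ hℓ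

/-- ★ **REGIME β IS NEVER FULL**: if the restriction `g|_{X=0}` equals `c·Q²` with `Q` vanishing at `β` (`Q ∈ (yᵢ − βᵢ)`), then `(X·g)^{p−1} ∈ (X^p, (yᵢ − βᵢ)^p)` — the hypersurface `X·g`
fails Fedderʼs test at the `k`-point `(0; β)`, for EVERY prime `p` and any cofactor `c` (`(cQ²)^{p−1} = c^{p−1}·Q^p·Q^{p−2}` and `Q^p ∈ ((yᵢ − βᵢ)^p)` by Frobenius). Shadows «exact
cancellation with ℓ₀ = 0 gives g|₀ = c·Q² ⇒ NEVER FULL» of `T-cone-transfer.md` regime β (at `k`-rational points). [OURS · R24.37 TC-β; cite: Fedder1983, Thm. 1.12 (context)] -/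
theorem X_mul_pow_mem_of_restrict_eq_mul_sq (k : Type) [Field k] (n : ℕ) (p : ℕ) [hp : Fact p.Prime] [CharP k p] (β : Fin n → k) (g : MvPolynomial (Fin (n + 1)) k)
    (c Q : MvPolynomial (Fin n) k) (hQ : Q ∈ Ideal.span (Set.range fun i : Fin n => (X i - C (β i) : MvPolynomial (Fin n) k)))
    (hσ : (aeval (Fin.cons 0 X : Fin (n + 1) → MvPolynomial (Fin n) k)) g = c * Q ^ 2) :
    (X 0 * g : MvPolynomial (Fin (n + 1)) k) ^ (p - 1) ∈ Ideal.span (Set.range fun j : Fin (n + 1) => (X j - C (Fin.cons 0 β j) : MvPolynomial (Fin (n + 1)) k) ^ p) := by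
  have hp1 : 1 ≤ p - 1 := Nat.le_sub_one_of_lt hp.out.one_lt
  rw [X_mul_pow_mem_iff k n hp.out.ne_zero β g, hσ, mul_pow, ← pow_mul]
  refine Ideal.mul_mem_left _ _ ?_
  -- `Q^{2(p−1)} = Q^p · Q^{p−2}`
  have hQp : Q ^ p ∈ Ideal.span (Set.range fun i : Fin n => (X i - C (β i) : MvPolynomial (Fin n) k) ^ p) := pow_char_mem_span_pow p _ Q hQ
  have hdecomp : Q ^ (2 * (p - 1)) = Q ^ p * Q ^ (p - 2) := by
    rw [← pow_add]; congr 1; omega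
  rw [hdecomp]
  exact Ideal.mul_mem_right _ _ hQp

end Summit.ResolutionOfSingularities.ResolutionOfSingularities.Theorems.FInjectiveMacaulayfication.FullXMulRestriction

end
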